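import Summits.HodgeConjecture.HodgeConjecture.Theorems.Ring2HypothesesDescentMotivatedAdjointStableAll
import Literature.AlgebraicGeometry.HodgeTheory.AbelianVarietyEndomorphismsHOne
import Literature.AlgebraicGeometry.HodgeTheory.ComplexOrientationCycleClassFacts
import HarnessLib

/-!
# Ring 2 hypotheses, descent face — André's Prop. 3.3, «à valeurs dans ℚ»: the trace form `(u, v) ↦ Tr([u]_* ∘ [v]_*')`
# of RATIONAL motivated correspondences is RATIONAL-valued (and symmetric), on the real carriers

research route conditional on HC_CM; not a corollary; Q11.4-sentence-2 already refuted in dim ≥ 3.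
Cell `pub-hodge-ring2` (Hodge ladder STAGE 3), seat `ring2-b05` (binder row b05
`Ring2.Hypotheses.MotivatedImpliesAlgebraicAV`), gen 39, part 5 (parts 1–4: `…MotivatedWeilForm`, `…MotivatedPositivity`,
`…MotivatedAdjointStable[All]`). `HC_CM` (`Theses.RankFourFaces.CMAbelianHodge`) does not occur in this file; nothing
here proves a case of the Hodge conjecture; the row b05 stays OPEN.

André 1996, Prop. 3.3 (p. 21): «la forme bilinéaire symétrique sur `C⁰_mot(X, X)` donnée par `(u, v) ↦ Tr(u ∘ *_H ᵗv *_H)`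
est à valeurs dans `ℚ`, et définie positive.» Parts 1–4 gave the positivity and the hermitian symmetry of the
`ℂ`-sesquilinear extension. This file gives the remaining clause on the real carriers, for RATIONAL motivated classes
`u, v ∈ A_motⁿ(X ⊗ X)_ℂ` (André's `ℚ`-structure `C⁰_mot(X, X)`; complex orientation family, whose Gysin maps preserve
rational classes): the operator `[u]_* ∘ [v]_*'` preserves the rational lattice `Hᵃ(X(ℂ); ℚ) ⊗ 1 ⊂ Hᵃ(X(ℂ); ℂ)`, so its
trace is rational; with the hermitian symmetry of part 1 the form is SYMMETRIC on rational classes.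

* §1 `trace_mem_range_ratCast_of_isRationalClass` — an endomorphism of `Hᵏ(X(ℂ); ℂ)` preserving rational classes has
  RATIONAL trace (matrix in a basis of rational classes, the tree's `repr_mem_range_ratCast_of_isRationalClass`);
  `form_nondegenerate` — the RATIONAL polarisation form `Q_ℚ = D.form` is non-degenerate (from `cform_nondegenerate`);
  **`isRationalClass_of_cform_adjoint`** — the `Q_D`-adjoint `T'` of an operator `S` preserving rational classes
  preserves rational classes (`Q_ℚ`-duality: `T'(v ⊗ 1) = v' ⊗ 1` for the `Q_ℚ`-Riesz representative `v'` of
  `w ↦ Q_ℚ(v, S_w)`); `isRationalClass_corrAction_complexOrientationFamily` (`[u]_*` preserves rational classes for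
  rational `u`).
* §2 **`trace_corrAction_comp_adjoint_mem_range_ratCast`** — «À VALEURS DANS ℚ»: for rational motivated `u, v` and
  `T'` the (conjugate = plain) `Q_D`-adjoint of `[v]_*`, `Tr([u]_* ∘ T') ∈ ℚ`;
  **`trace_corrAction_comp_adjoint_symm`** — «SYMÉTRIQUE»: `Tr([u]_* ∘ [v]_*') = Tr([v]_* ∘ [u]_*')`.

No definition, no named fact, no sorry. References: Andre1996Motifs (Prop. 3.3 p. 21, Prop. 3.2.1 p. 20),
VoisinHodgeI2002 (§7.1.1–7.1.2), Kleiman1968AlgebraicCycles (§3, 3.11).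
-/

noncomputable section

-- every declaration of this problem lives in `Summit.HodgeConjecture.HodgeConjecture.…` (summit = sub-problem)
set_option linter.dupNamespace false

open CategoryTheory AlgebraicGeometry MonoidalCategory CartesianMonoidalCategory
open Literature.AlgebraicTopology.SingularHomology Literature.Geometry.Kaehler
open Literature.AlgebraicGeometry Literature.AlgebraicGeometry.Motives
  Literature.AlgebraicGeometry.HodgeTheory
open Summit.HodgeConjecture.HodgeConjecture.Theorems.LefschetzStandardB (conjClass_corrAction)

namespace Summit.HodgeConjecture.HodgeConjecture.Theorems

variable {n : ℕ} {X : SchemeOver ℂ}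

/-! ## §1 Rational traces, the rational polarisation form, and the rationality of adjoints -/

/-- **An endomorphism of `Hᵏ(X(ℂ); ℂ)` preserving rational classes has rational trace**: in a `ℂ`-basis of
`Hᵏ(X(ℂ); ℂ)` made of rational classes (rational classes span, `span_isRationalClass_eq_top_of_isSmoothProjective_holds`)
the matrix of `F` has rational entries (`repr_mem_range_ratCast_of_isRationalClass`). [cite: VoisinHodgeI2002, §7.1.1]
[cite: Andre1996Motifs, Prop. 3.2.1 (p. 20)] -/
theorem trace_mem_range_ratCast_of_isRationalClass (hX : IsSmoothProjective n X) {k : ℕ}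
    (F : complexBetti X k →ₗ[ℂ] complexBetti X k) (hF : ∀ c, IsRationalClass c → IsRationalClass (F c)) :
    LinearMap.trace ℂ _ F ∈ Set.range ((↑) : ℚ → ℂ) := by
  classical
  haveI : Module.Finite ℂ (complexBetti X k) := finite_complexBetti hX k
  obtain ⟨t, hts, htspan, hli⟩ := exists_linearIndependent ℂ {c : complexBetti X k | IsRationalClass c}
  have hspan : Submodule.span ℂ {c : complexBetti X k | IsRationalClass c} = ⊤ :=
    span_isRationalClass_eq_top_of_isSmoothProjective_holds n X hX k
  haveI : Fintype t := (hli.set_finite_of_isNoetherian).fintype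
  let b : Module.Basis t ℂ (complexBetti X k) := Module.Basis.mk hli (by rw [Subtype.range_coe, htspan, hspan])
  have hb : ∀ i, IsRationalClass (b i) := fun i ↦ by
    rw [Module.Basis.mk_apply]
    exact hts i.2
  rw [LinearMap.trace_eq_matrix_trace ℂ b, Matrix.trace]
  have hdiag : ∀ i, LinearMap.toMatrix b b F i i ∈ Set.range ((↑) : ℚ → ℂ) := fun i ↦ by
    rw [LinearMap.toMatrix_apply]
    exact repr_mem_range_ratCast_of_isRationalClass b hb (hF _ (hb i)) i
  choose q hq using hdiag
  refine ⟨∑ i, q i, ?_⟩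
  push_cast
  exact Finset.sum_congr rfl fun i _ ↦ by rw [hq i]; rfl

/-- **The RATIONAL polarisation form `Q_ℚ = D.form` on `Hᵏ(X(ℂ); ℚ)` is non-degenerate**: `Q_ℚ(v, w) = Q_D(v ⊗ 1, w ⊗ 1)`
(`algebraMap_form`), rational classes span `Hᵏ(X(ℂ); ℂ)`, and `Q_D` is non-degenerate (part 1,
`cform_nondegenerate`); the right half by the `(-1)ᵏ`-symmetry. [cite: VoisinHodgeI2002, §7.1.2] -/
theorem form_nondegenerate (hX : IsSmoothProjective n X) (D : KaehlerRationalDatum n X) (k : ℕ) :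
    (D.form hX k).Nondegenerate := by
  have hleft : ∀ v : singularCohomology ℚ ℚ (ComplexPoints X) k, (∀ w, D.form hX k v w = 0) → v = 0 := by
    intro v hv
    apply ofRatClass_injective k
    rw [map_zero]
    refine (cform_nondegenerate hX D k).1 _ fun y ↦ ?_
    -- `Q_D(v ⊗ 1, ·)` vanishes on rational classes, which span
    have hy : y ∈ Submodule.span ℂ {c : complexBetti X k | IsRationalClass c} := by
      rw [span_isRationalClass_eq_top_of_isSmoothProjective_holds n X hX k]; trivial
    refine (LinearMap.eqOn_span (f := D.cform hX k (ofRatClass (ComplexPoints X) k v)) (g := 0) ?_ hy).trans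
      (LinearMap.zero_apply _)
    intro c hc
    obtain ⟨w, rfl⟩ := (isRationalClass_iff_mem_range_ofRatClass c).1 hc
    rw [LinearMap.zero_apply, ← D.algebraMap_form hX, hv w, map_zero]
  refine ⟨fun v hv ↦ hleft v hv, fun w hw ↦ hleft w fun v ↦ ?_⟩
  have h := hw v
  have hflip : D.form hX k w v = (-1 : ℚ) ^ k * D.form hX k v w := by
    simp only [KaehlerRationalDatum.form]
    exact polarizationForm_flip _ _ _ v w
  rw [hflip, h, mul_zero]

/-- **The `Q_D`-adjoint of a rational operator is rational.** Let `S : Hᵏ(X(ℂ); ℂ) → Hᵏ(X(ℂ); ℂ)` map rational classes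
to rational classes and let `T'` satisfy `Q_D(T' x, y) = Q_D(x, S y)` for all `x, y`. Then `T'` maps rational classes to
rational classes: for `v` rational, `w ↦ Q_D(T'(v ⊗ 1), w ⊗ 1) = Q_ℚ(v, S_w)` is a `ℚ`-linear functional on
`Hᵏ(X(ℂ); ℚ)`, represented (`Q_ℚ` non-degenerate, `LinearMap.BilinForm.toDual`) by a rational `v'`; then
`Q_D(T'(v ⊗ 1) − v' ⊗ 1, ·)` vanishes on the spanning rational classes, so `T'(v ⊗ 1) = v' ⊗ 1`.
[cite: VoisinHodgeI2002, §7.1.1–7.1.2] [cite: Andre1996Motifs, Prop. 3.2.1 (p. 20) and Prop. 3.3 (p. 21)] -/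
theorem isRationalClass_of_cform_adjoint (hX : IsSmoothProjective n X) (D : KaehlerRationalDatum n X) {k : ℕ}
    {S T' : complexBetti X k →ₗ[ℂ] complexBetti X k} (hS : ∀ c, IsRationalClass c → IsRationalClass (S c))
    (hT' : ∀ x y, D.cform hX k (T' x) y = D.cform hX k x (S y)) {c : complexBetti X k} (hc : IsRationalClass c) :
    IsRationalClass (T' c) := by
  classical
  haveI := finite_singularCohomology_rat_complexPoints hX k
  obtain ⟨v, rfl⟩ := (isRationalClass_iff_mem_range_ofRatClass c).1 hc
  -- the rational values `Q_D(T'(v ⊗ 1), w ⊗ 1) = Q_ℚ(v, S_w)`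
  have hq : ∀ w : singularCohomology ℚ ℚ (ComplexPoints X) k, ∃ q : ℚ,
      algebraMap ℚ ℂ q = D.cform hX k (T' (ofRatClass (ComplexPoints X) k v)) (ofRatClass (ComplexPoints X) k w) := by
    intro w
    obtain ⟨w', hw'⟩ := (isRationalClass_iff_mem_range_ofRatClass _).1 (hS _ (isRationalClass_ofRatClass w))
    refine ⟨D.form hX k v w', ?_⟩
    rw [hT', ← hw', D.algebraMap_form hX]
  choose ℓf hℓf using hq
  have hinj : Function.Injective (algebraMap ℚ ℂ) := (algebraMap ℚ ℂ).injective
  let ℓ : Module.Dual ℚ (singularCohomology ℚ ℚ (ComplexPoints X) k) :=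
    { toFun := ℓf
      map_add' := fun w w' ↦ hinj (by rw [map_add, hℓf, hℓf, hℓf, map_add, map_add])
      map_smul' := fun q w ↦ hinj (by
        rw [RingHom.id_apply, smul_eq_mul, map_mul, hℓf, hℓf, ofRatClass_smul, map_smul, smul_eq_mul,
          eq_ratCast]) }
  -- its `Q_ℚ`-Riesz representative `v'`
  set v' := ((D.form hX k).toDual (form_nondegenerate hX D k)).symm ℓ with hv'
  have hv'ℓ : ∀ w, D.form hX k v' w = ℓf w := fun w ↦
    LinearMap.BilinForm.apply_toDual_symm_apply (B := D.form hX k) (hB := form_nondegenerate hX D k) ℓ w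
  -- `T'(v ⊗ 1) = v' ⊗ 1`
  have heq : T' (ofRatClass (ComplexPoints X) k v) = ofRatClass (ComplexPoints X) k v' := by
    rw [← sub_eq_zero]
    refine (cform_nondegenerate hX D k).1 _ fun y ↦ ?_
    have hy : y ∈ Submodule.span ℂ {c : complexBetti X k | IsRationalClass c} := by
      rw [span_isRationalClass_eq_top_of_isSmoothProjective_holds n X hX k]; trivial
    refine (LinearMap.eqOn_span
      (f := D.cform hX k (T' (ofRatClass (ComplexPoints X) k v) - ofRatClass (ComplexPoints X) k v')) (g := 0) ?_ hy).trans
      (LinearMap.zero_apply _)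
    intro c hc'
    obtain ⟨w, rfl⟩ := (isRationalClass_iff_mem_range_ofRatClass c).1 hc'
    rw [LinearMap.zero_apply, map_sub, LinearMap.sub_apply, ← hℓf, ← D.algebraMap_form hX, hv'ℓ, sub_self]
  rw [heq]
  exact isRationalClass_ofRatClass v'

/-- **`[u]_*` preserves rational classes** for a RATIONAL class `u ∈ H^{2e}((W ⊗ X)(ℂ); ℂ)` and the complex orientation
family (pull-back, cup product and the complex Gysin morphisms preserve rational classes —
`isRationalClass_complexGysin_complexOrientationFamily`). [cite: VoisinHodgeI2002, §7.1.1 and §7.3.2] -/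
theorem isRationalClass_corrAction_complexOrientationFamily {m : ℕ} {W : SchemeOver ℂ} (hW : IsSmoothProjective m W)
    (hX : IsSmoothProjective n X) {e a b : ℕ} (hab : a + 2 * e = b + 2 * n) {γ : complexBetti (W ⊗ X) (2 * e)}
    (hγ : IsRationalClass γ) {c : complexBetti X a} (hc : IsRationalClass c) :
    IsRationalClass (corrAction complexOrientationFamily hW hX hab γ c) := by
  rw [corrAction_apply]
  exact isRationalClass_complexGysin_complexOrientationFamily (hW.tensor_holds hX) hW (fst W X) _
    ((hc.map (AlgPoints.mapContinuous (L := ℂ) (snd W X))).cup rfl hγ)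

/-! ## §2 «À valeurs dans ℚ» and «symétrique» -/

/-- **ANDRÉ 1996, PROP. 3.3 — «À VALEURS DANS ℚ» ON THE REAL CARRIERS.** For `X` smooth projective of dimension `n`, a
Kähler–rational datum `D`, a degree `a`, RATIONAL motivated classes `u, v ∈ A_motⁿ(X ⊗ X)_ℂ` (André's `C⁰_mot(X, X)`,
`ℚ`-structure), the complex orientation family, and `T'` the conjugate `Q_D`-adjoint of `[v]_*|_{Hᵃ}` (= its plain
`Q_D`-adjoint, `v` being real — André's `v' = *ᵗv*`): the value `Tr([u]_* ∘ T')` of André's form is a RATIONAL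
number. (`[u]_*` and `[v]_*` preserve rational classes, hence so does the adjoint `T'` by `Q_ℚ`-duality, and a
rational operator has rational trace.) [cite: Andre1996Motifs, Prop. 3.3 (p. 21)] [cite: Kleiman1968AlgebraicCycles, §3, 3.11] -/
theorem trace_corrAction_comp_adjoint_mem_range_ratCast (hX : IsSmoothProjective n X) (D : KaehlerRationalDatum n X)
    (a : ℕ) {u v : complexBetti (X ⊗ X) (2 * n)} (hu : IsRationalClass u) (hv : IsRationalClass v)
    {T' : complexBetti X a →ₗ[ℂ] complexBetti X a}
    (hT' : ∀ x y, D.cform hX a (T' x) y = D.cform hX a x (conjClass (ComplexPoints X) a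
      (corrAction complexOrientationFamily hX hX (rfl : a + 2 * n = a + 2 * n) v (conjClass (ComplexPoints X) a y)))) :
    LinearMap.trace ℂ _ (corrAction complexOrientationFamily hX hX (rfl : a + 2 * n = a + 2 * n) u ∘ₗ T') ∈
      Set.range ((↑) : ℚ → ℂ) := by
  -- `conj [v]_* conj = [conj v]_* = [v]_*`
  have hT'' : ∀ x y, D.cform hX a (T' x) y =
      D.cform hX a x (corrAction complexOrientationFamily hX hX (rfl : a + 2 * n = a + 2 * n) v y) := fun x y ↦ by
    rw [hT', conjClass_corrAction hX hX rfl v, conjClass_conjClass, hv.conjClass_eq]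
  refine trace_mem_range_ratCast_of_isRationalClass hX _ fun c hc ↦ ?_
  rw [LinearMap.comp_apply]
  exact isRationalClass_corrAction_complexOrientationFamily hX hX rfl hu
    (isRationalClass_of_cform_adjoint hX D
      (fun c hc ↦ isRationalClass_corrAction_complexOrientationFamily hX hX rfl hv hc) hT'' hc)

/-- **ANDRÉ 1996, PROP. 3.3 — «SYMÉTRIQUE» ON THE REAL CARRIERS**: for rational MOTIVATED `u, v ∈ A_motⁿ(X ⊗ X)_ℂ` with
conjugate `Q_D`-adjoints `S'` of `[u]_*` and `T'` of `[v]_*` on `Hᵃ(X(ℂ); ℂ)`, `Tr([u]_* ∘ T') = Tr([v]_* ∘ S')` — the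
hermitian symmetry of part 1 (`trace_comp_cform_adjoint_conj_symm`, motivated operators preserve the Hodge types)
together with the rationality of the values. [cite: Andre1996Motifs, Prop. 3.3 (p. 21)] -/
theorem trace_corrAction_comp_adjoint_symm (hX : IsSmoothProjective n X) (D : KaehlerRationalDatum n X) (a : ℕ)
    {u v : complexBetti (X ⊗ X) (2 * n)} (hu : IsRationalClass u) (hv : IsRationalClass v)
    (hum : u ∈ motivatedClasses (n + n) (X ⊗ X) n) (hvm : v ∈ motivatedClasses (n + n) (X ⊗ X) n)
    {S' T' : complexBetti X a →ₗ[ℂ] complexBetti X a}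
    (hS' : ∀ x y, D.cform hX a (S' x) y = D.cform hX a x (conjClass (ComplexPoints X) a
      (corrAction complexOrientationFamily hX hX (rfl : a + 2 * n = a + 2 * n) u (conjClass (ComplexPoints X) a y))))
    (hT' : ∀ x y, D.cform hX a (T' x) y = D.cform hX a x (conjClass (ComplexPoints X) a
      (corrAction complexOrientationFamily hX hX (rfl : a + 2 * n = a + 2 * n) v (conjClass (ComplexPoints X) a y)))) :
    LinearMap.trace ℂ _ (corrAction complexOrientationFamily hX hX (rfl : a + 2 * n = a + 2 * n) u ∘ₗ T') =
      LinearMap.trace ℂ _ (corrAction complexOrientationFamily hX hX (rfl : a + 2 * n = a + 2 * n) v ∘ₗ S') := by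
  obtain ⟨A⟩ := nonempty_hodgeModel_holds hX
  have hXX : IsSmoothProjective (n + n) (X ⊗ X) := hX.tensor_holds hX
  have hsymm := trace_comp_cform_adjoint_conj_symm hX D A
    (fun pq x hx ↦ corrAction_mem_typePiece_of_isOfHodgeType complexOrientationFamily hX A
      (isOfHodgeType_of_mem_motivatedClasses hXX hum) pq hx) hS'
    (fun pq x hx ↦ corrAction_mem_typePiece_of_isOfHodgeType complexOrientationFamily hX A
      (isOfHodgeType_of_mem_motivatedClasses hXX hvm) pq hx) hT'
  -- the right-hand trace is rational, hence fixed by conjugation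
  obtain ⟨q, hq⟩ := trace_corrAction_comp_adjoint_mem_range_ratCast hX D a hv hu hS'
  rw [hsymm, ← hq, map_ratCast]

end Summit.HodgeConjecture.HodgeConjecture.Theorems

end
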